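import Mathlib
import Summits.NavierStokesRegularity.NavierStokesRegularity.Theorems.FilamentSkeletonRssSelectionBoxRJRungTruePartnerDerivTools

/-!
# Route `FilamentSkeletonRss` · crux `SelectionBoxRJ` (stmt-NavierStokesRegularity-21220) — rung tools (R2, brick 2c):
# the true partner forcing is `C¹`-close to the frozen forcing

Lane `ns-filament-19175-p1` (g7); helper file `--supports stmt-NavierStokesRegularity-21220`, route-independent.

`partnerField_deriv_sub_le`: for a `C¹` unit-speed curve `z` through `P = (√Γ/5, 0, 0)` whose tangent stays within `θ ≤ 1/500`
of `e = (0, 1, 1)/√2`, the true partner forcing `f = (Γ·4/(4π)) • F[R_π∘z] ∘ z` (regularised Biot–Savart field of the rotated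
copy, evaluated on the curve) is differentiable and `‖f′(t) − U′(t)‖ ≤ 710·θ` for all `t`, where `U` is the frozen forcing of
rung 0 (the straight partner line's field along the straight line `ℓ₁`).  The three terms: gradient curve-Lipschitz seen
from `z t` (`biotSavart_grad_curveLipschitz`, `≤ 356θ`), translation of the base point by `‖z t − ℓ₁ t‖ ≤ θ|t|` realised as a
translated partner line (`lineField_translate_fderiv` + `biotSavart_grad_curveLipschitz` with `B = θ|t|`, `≤ 303θ`), and the
line's gradient (`biotSavart_fderiv_norm_le`) against the tangent error (`≤ 50θ`).

HONEST FRAMING.  Bookkeeping for the rung ladder of a HYPOTHETICAL filament box (input `ε₁` of the zero analysis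
`slip_zero_package`); NOT an instance of `SelectionBoxRJ`; nothing here is a claim about Navier–Stokes regularity or blow-up.
-/

set_option linter.dupNamespace false -- `Theorems.…Theorems`-style path/namespace repetition is the tree convention

noncomputable section

namespace Summit.NavierStokesRegularity.NavierStokesRegularity.Theorems

open Set Function Filter MeasureTheory Real
open Literature.Analysis.FluidPDE
open Summit.NavierStokesRegularity.NavierStokesRegularity.Theorems.SkeletonEquilibrium.Sketch
open scoped InnerProductSpace Topology

namespace SelectionBoxRJRung

/-- **`C¹` closeness of the true partner forcing to the frozen one (R2, brick 2c).**  For a `C¹` unit-speed curve `z`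
through `P = (√Γ/5, 0, 0)` with `‖z′ − e‖ ≤ θ ≤ 1/500` everywhere, the TRUE partner forcing
`f(t) = (Γ·4/(4π)) ∫ K₁(z t − R_π z σ) (R_π∘z)′(σ) × (z t − R_π z σ) dσ` is differentiable and its derivative is within
`710·θ` of the derivative of the frozen forcing `U` (three terms: the gradient's Lipschitz dependence on the partner curve seen
from `z t` (`≤ 356θ`), the translation from `z t` to `ℓ₁ t` (`≤ 303θ`), and the line's gradient against the tangent error
(`≤ 50θ`)).  With `θ = 1/3000` this is the input `ε₁ ≤ 71/300` of the zero analysis.  MODEL-side bookkeeping for a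
HYPOTHETICAL filament box only. [folklore] -/
theorem partnerField_deriv_sub_le {Γ θ : ℝ} (hΓ : 0 < Γ) (hθ0 : 0 ≤ θ) (hθ1 : θ ≤ 1 / 500)
    (U : ℝ → EuclideanSpace ℝ (Fin 3))
    (hU : ∀ t, U t = (2 * Γ / Real.pi / (4 * Γ / 25 + 1 + t ^ 2)) •
      ((2 * Real.sqrt Γ / 5) • (WithLp.toLp 2 ![0, (Real.sqrt 2)⁻¹, (Real.sqrt 2)⁻¹] : EuclideanSpace ℝ (Fin 3)) -
        t • WithLp.toLp 2 ![(1:ℝ), 0, 0]))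
    {z : ℝ → EuclideanSpace ℝ (Fin 3)} (hz : ContDiff ℝ 1 z) (hunit : ∀ u, ‖deriv z u‖ = 1)
    (hz0 : z 0 = WithLp.toLp 2 ![Real.sqrt Γ / 5, 0, 0])
    (hθ : ∀ s, ‖deriv z s - WithLp.toLp 2 ![0, (Real.sqrt 2)⁻¹, (Real.sqrt 2)⁻¹]‖ ≤ θ)
    (f : ℝ → EuclideanSpace ℝ (Fin 3))
    (hf : ∀ t, f t = (Γ * 4 / (4 * Real.pi)) • ∫ σ : ℝ,
        ((‖z t - ((2 * ⟪z σ, EuclideanSpace.single 2 1⟫_ℝ) • (EuclideanSpace.single (2 : Fin 3) (1 : ℝ)) - z σ)‖ ^ 2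
            + 1) ^ (3 / 2 : ℝ))⁻¹ •
          cross (deriv (fun u => (2 * ⟪z u, EuclideanSpace.single 2 1⟫_ℝ) •
              (EuclideanSpace.single (2 : Fin 3) (1 : ℝ)) - z u) σ)
            (z t - ((2 * ⟪z σ, EuclideanSpace.single 2 1⟫_ℝ) • (EuclideanSpace.single (2 : Fin 3) (1 : ℝ)) - z σ))) :
    Differentiable ℝ f ∧ ∀ t, ‖deriv f t - deriv U t‖ ≤ 710 * θ := by
  have hG : 0 < Real.sqrt Γ := Real.sqrt_pos.2 hΓ
  have hG2 : Real.sqrt Γ ^ 2 = Γ := Real.sq_sqrt hΓ.le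
  have hzd : Differentiable ℝ z := hz.differentiable one_ne_zero
  have hπ := Real.pi_gt_d2
  have hcΓ : 0 ≤ Γ * 4 / (4 * Real.pi) := by positivity
  obtain ⟨P, hP⟩ : ∃ P : EuclideanSpace ℝ (Fin 3), P = WithLp.toLp 2 ![Real.sqrt Γ / 5, 0, 0] := ⟨_, rfl⟩
  obtain ⟨e, he⟩ : ∃ e : EuclideanSpace ℝ (Fin 3), e = WithLp.toLp 2 ![0, (Real.sqrt 2)⁻¹, (Real.sqrt 2)⁻¹] := ⟨_, rfl⟩
  obtain ⟨Q, hQ⟩ : ∃ Q : EuclideanSpace ℝ (Fin 3), Q = WithLp.toLp 2 ![-(Real.sqrt Γ / 5), 0, 0] := ⟨_, rfl⟩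
  obtain ⟨e₂, he₂⟩ : ∃ e₂ : EuclideanSpace ℝ (Fin 3), e₂ = WithLp.toLp 2 ![0, -(Real.sqrt 2)⁻¹, (Real.sqrt 2)⁻¹] :=
    ⟨_, rfl⟩
  have he₂1 : ‖e₂‖ = 1 := by rw [he₂]; exact norm_tangent₂
  -- the rotation as a continuous linear map and the partner curve `X = R_π ∘ z`
  set e₃ : EuclideanSpace ℝ (Fin 3) := EuclideanSpace.single (2 : Fin 3) (1 : ℝ) with he₃
  set L : EuclideanSpace ℝ (Fin 3) →L[ℝ] EuclideanSpace ℝ (Fin 3) :=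
    (2 : ℝ) • (innerSL ℝ e₃).smulRight e₃ - ContinuousLinearMap.id ℝ (EuclideanSpace ℝ (Fin 3)) with hLdef
  have hL : ∀ y, L y = (2 * ⟪y, e₃⟫_ℝ) • e₃ - y := fun y => by
    simp [hLdef, smul_smul, real_inner_comm]
  set X : ℝ → EuclideanSpace ℝ (Fin 3) := fun u => (2 * ⟪z u, e₃⟫_ℝ) • e₃ - z u with hXdef
  have hXL : X = fun u => L (z u) := by funext u; rw [hXdef, hL]
  have hXc : ContDiff ℝ 1 X := by rw [hXL]; exact L.contDiff.comp hz
  have hXd : ∀ u, deriv X u = L (deriv z u) := fun u => by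
    rw [hXL]; exact (L.hasFDerivAt.comp_hasDerivAt u (hzd u).hasDerivAt).deriv
  have hdX : ∀ u, ‖deriv X u‖ ≤ 1 := fun u => by
    rw [hXd u, hL, norm_rotPi, hunit u]
  have hgrowX : ∀ u, (1 - θ) * |u| - 0 ≤ ‖X u‖ := fun u => by
    rw [sub_zero, hXdef]; dsimp only; rw [norm_rotPi]
    exact arc_norm_ge hΓ.le hzd hz0 hθ u
  -- the straight partner line `X₂` and its translate `X₃ = X₂ + d`, `d = ℓ₁ t − z t`
  set X₂ : ℝ → EuclideanSpace ℝ (Fin 3) := fun u => Q + u • e₂ with hX₂def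
  have hX₂c : ContDiff ℝ 1 X₂ := by rw [hX₂def]; fun_prop
  have hX₂d : ∀ u, deriv X₂ u = e₂ := fun u => by rw [hX₂def, deriv_line]
  have hdX₂ : ∀ u, ‖deriv X₂ u‖ ≤ 1 := fun u => by rw [hX₂d u, he₂1]
  have hX₂n : ∀ u, |u| ≤ ‖X₂ u‖ := fun u => by
    have h2 : ‖X₂ u‖ ^ 2 = Γ / 25 + u ^ 2 := by rw [hX₂def]; dsimp only; rw [hQ, he₂]; exact norm_sq_line₂ Γ u hΓ.le
    have hn := norm_nonneg (X₂ u)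
    nlinarith only [h2, hn, sq_abs u, abs_nonneg u, hΓ, mul_nonneg hn (abs_nonneg u)]
  have hgrowX₂ : ∀ u, (1 - θ) * |u| - 0 ≤ ‖X₂ u‖ := fun u => by
    have := hX₂n u; rw [sub_zero]; linarith only [this, mul_nonneg hθ0 (abs_nonneg u)]
  -- the two fields
  obtain ⟨F, hFdef⟩ : ∃ F : EuclideanSpace ℝ (Fin 3) → EuclideanSpace ℝ (Fin 3), F = fun y => ∫ u : ℝ,
      ((‖y - X u‖ ^ 2 + 1 ^ 2) ^ (3 / 2 : ℝ))⁻¹ • cross (deriv X u) (y - X u) := ⟨_, rfl⟩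
  obtain ⟨F₂, hF₂def⟩ : ∃ F₂ : EuclideanSpace ℝ (Fin 3) → EuclideanSpace ℝ (Fin 3), F₂ = fun y => ∫ u : ℝ,
      ((‖y - X₂ u‖ ^ 2 + 1 ^ 2) ^ (3 / 2 : ℝ))⁻¹ • cross (deriv X₂ u) (y - X₂ u) := ⟨_, rfl⟩
  have hFd : Differentiable ℝ F := by
    rw [hFdef]; exact stub_biotSavartDifferentiable 1 (1 - θ) 0 X one_ne_zero (by linarith only [hθ1]) hXc hdX hgrowX
  have hF₂d : Differentiable ℝ F₂ := by
    rw [hF₂def]; exact stub_biotSavartDifferentiable 1 (1 - θ) 0 X₂ one_ne_zero (by linarith only [hθ1]) hX₂c hdX₂ hgrowX₂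
  -- `f = c • F ∘ z` and `U = c • F₂ ∘ ℓ₁`
  have hfF : f = fun t => (Γ * 4 / (4 * Real.pi)) • F (z t) := by
    funext t; rw [hf t, hFdef]; simp only [one_pow, hXdef]
  have hUF : U = fun t => (Γ * 4 / (4 * Real.pi)) • F₂ (P + t • e) := by
    funext t
    rw [hP, he, U_eq_lineBiotSavart hΓ.le U hU t, hF₂def]
    simp only [hX₂d, one_pow]; simp only [hX₂def, hQ, he₂]
  have hfD : ∀ t, HasDerivAt f ((Γ * 4 / (4 * Real.pi)) • (fderiv ℝ F (z t)) (deriv z t)) t := fun t => by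
    rw [hfF]
    have h := ((hFd (z t)).hasFDerivAt.comp_hasDerivAt t (hzd t).hasDerivAt).const_smul (Γ * 4 / (4 * Real.pi))
    exact h
  have hUD : ∀ t, HasDerivAt U ((Γ * 4 / (4 * Real.pi)) • (fderiv ℝ F₂ (P + t • e)) e) t := fun t => by
    rw [hUF]
    have h := ((hF₂d (P + t • e)).hasFDerivAt.comp_hasDerivAt t (hasDerivAt_line P e t)).const_smul
      (Γ * 4 / (4 * Real.pi))
    exact h
  refine ⟨fun t => (hfD t).differentiableAt, fun t => ?_⟩
  rw [(hfD t).deriv, (hUD t).deriv, ← smul_sub, norm_smul, Real.norm_eq_abs, abs_of_nonneg hcΓ]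
  /- geometry seen from `z t` (Term 1) — as in the `C⁰` estimate -/
  have hLe : L e = e₂ := by rw [hL, he, he₂]; exact rotPi_tangent
  have htan : ∀ u, ‖deriv X u - deriv X₂ u‖ ≤ θ := fun u => by
    rw [hXd u, hX₂d u, ← hLe, hL, hL, rotPi_sub_norm, he]; exact hθ u
  have hLℓ : ∀ u, L (P + u • e) = X₂ u := fun u => by
    rw [hL, hP, he, hX₂def]; dsimp only; rw [hQ, he₂]; exact rotPi_line Γ u
  have hpos : ∀ u, ‖X u - X₂ u‖ ≤ θ * |u - 0| + 0 := fun u => by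
    rw [sub_zero, add_zero, ← hLℓ u, hXL]; dsimp only; rw [hL, hL, rotPi_sub_norm]
    have := arc_displacement_le hzd hz0 hθ u
    rwa [← hP, ← he] at this
  have hc : 0 < 1 - 2 * θ := by linarith only [hθ1]
  have hθ4 : θ ≤ 1 / 4 := by linarith only [hθ1]
  have hD : 0 < (1 - 2 * θ) * (2 * Real.sqrt Γ / 5) := mul_pos hc (by positivity)
  have hsep := fun u => nearStraight_sep_rot hΓ hθ0 hθ4 hzd hz0 hθ t u
  have hsepL := fun u => nearStraight_sep_line hΓ hθ0 hθ4 hzd hz0 hθ t u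
  have hfar : ∀ u, (1 - 2 * θ) * (2 * Real.sqrt Γ / 5) ≤ ‖z t - X u‖ := fun u => (hsep u).1
  have hfar' : ∀ u, (1 - 2 * θ) * (2 * Real.sqrt Γ / 5) ≤ ‖z t - X₂ u‖ := fun u => by
    have h := (hsepL u).1
    rw [← hQ, ← he₂] at h
    have : (1 - 2 * θ) * (2 * Real.sqrt Γ / 5) ≤ (1 - θ) * (2 * Real.sqrt Γ / 5) :=
      mul_le_mul_of_nonneg_right (by linarith only [hθ0]) (by positivity)
    exact this.trans h
  have hesc : ∀ u, (1 - 2 * θ) * |u - 0| - 0 ≤ ‖z t - X u‖ := fun u => by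
    rw [sub_zero, sub_zero]; exact (hsep u).2.1
  have hesc' : ∀ u, (1 - 2 * θ) * |u - 0| - 0 ≤ ‖z t - X₂ u‖ := fun u => by
    rw [sub_zero, sub_zero]
    have h := (hsepL u).2
    rw [← hQ, ← he₂] at h
    have : (1 - 2 * θ) * |u| ≤ (1 - θ) * |u| :=
      mul_le_mul_of_nonneg_right (by linarith only [hθ0]) (abs_nonneg u)
    exact this.trans h
  /- geometry seen from `ℓ₁ t` (Terms 2 and 3) -/
  have hN1sq : ‖P + t • e - Q‖ ^ 2 = 4 * Γ / 25 + t ^ 2 := by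
    rw [hP, he, hQ, pt₁_sub_P₂, VortexFilament.norm_sq_toLp_three]
    have hs := inv_sqrt_two_mul_self
    have hGG : Real.sqrt Γ * Real.sqrt Γ = Γ := Real.mul_self_sqrt hΓ.le
    linear_combination (2 * t ^ 2) * hs + (4 / 25) * hGG
  have hN1 : 0 ≤ ‖P + t • e - Q‖ := norm_nonneg _
  have hN1G : 2 * Real.sqrt Γ / 5 ≤ ‖P + t • e - Q‖ := by
    nlinarith only [hN1sq, hG2, hG, sq_nonneg t, mul_nonneg hN1 hG.le, hN1]
  have hN1pos : 0 < ‖P + t • e - Q‖ := lt_of_lt_of_le (by positivity) hN1G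
  have hsq : ∀ u, ‖P + t • e - Q‖ ≤ Real.sqrt (4 * Γ / 25 + t ^ 2 + u ^ 2) := fun u =>
    Real.le_sqrt_of_sq_le (by rw [hN1sq]; linarith only [sq_nonneg u])
  have hsqu : ∀ u, |u| ≤ Real.sqrt (4 * Γ / 25 + t ^ 2 + u ^ 2) := fun u => by
    rw [← Real.sqrt_sq_eq_abs]; exact Real.sqrt_le_sqrt (by linarith only [sq_nonneg t, hΓ])
  have hℓX₂ : ∀ u, ‖P + t • e - X₂ u‖ = Real.sqrt (4 * Γ / 25 + t ^ 2 + u ^ 2) := fun u => by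
    rw [hX₂def]; dsimp only; rw [hP, he, hQ, he₂]; exact line_sep_sqrt Γ t u hΓ.le
  have hzX₂ : ∀ u, (1 - θ) * Real.sqrt (4 * Γ / 25 + t ^ 2 + u ^ 2) ≤ ‖z t - X₂ u‖ := fun u => by
    rw [hX₂def]; dsimp only; rw [hQ, he₂]; exact nearStraight_sep_line_sqrt hΓ hθ0 hzd hz0 hθ t u
  -- Term 3: the line's gradient at `ℓ₁ t`
  have hfar3 : ∀ u, ‖P + t • e - Q‖ ≤ ‖P + t • e - X₂ u‖ := fun u => by rw [hℓX₂ u]; exact hsq u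
  have hesc3 : ∀ u, 1 * |u - 0| - 0 ≤ ‖P + t • e - X₂ u‖ := fun u => by
    rw [sub_zero, sub_zero, one_mul, hℓX₂ u]; exact hsqu u
  -- Term 2: translate the line by `d = ℓ₁ t − z t`
  obtain ⟨d, hd⟩ : ∃ d : EuclideanSpace ℝ (Fin 3), d = P + t • e - z t := ⟨_, rfl⟩
  have hdn : ‖d‖ ≤ θ * |t| := by
    rw [hd, norm_sub_rev]
    have := arc_displacement_le hzd hz0 hθ t
    rwa [← hP, ← he] at this
  obtain ⟨X₃, hX₃def⟩ : ∃ X₃ : ℝ → EuclideanSpace ℝ (Fin 3), X₃ = fun u => Q + u • e₂ + d := ⟨_, rfl⟩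
  have hX₃c : ContDiff ℝ 1 X₃ := by rw [hX₃def]; fun_prop
  have hX₃d : ∀ u, deriv X₃ u = e₂ := fun u => by
    have : X₃ = fun u : ℝ => (Q + d) + u • e₂ := by rw [hX₃def]; funext u; abel
    rw [this, deriv_line]
  have hdX₃ : ∀ u, ‖deriv X₃ u‖ ≤ 1 := fun u => by rw [hX₃d u, he₂1]
  have hX₃₂ : ∀ u, X₃ u - X₂ u = d := fun u => by rw [hX₃def, hX₂def]; dsimp only; abel
  have hgrowX₃ : ∀ u, (1 - θ) * |u| - θ * |t| ≤ ‖X₃ u‖ := fun u => by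
    have h1 : ‖X₂ u‖ - ‖d‖ ≤ ‖X₃ u‖ := by
      have := norm_sub_norm_le (X₂ u) (X₂ u - X₃ u)
      rw [sub_sub_cancel, show X₂ u - X₃ u = -d by rw [← hX₃₂ u]; abel, norm_neg] at this
      linarith only [this]
    have h2 := hX₂n u
    linarith only [h1, h2, hdn, mul_nonneg hθ0 (abs_nonneg u)]
  have htan2 : ∀ u, ‖deriv X₃ u - deriv X₂ u‖ ≤ 0 := fun u => by rw [hX₃d, hX₂d, sub_self, norm_zero]
  have hpos2 : ∀ u, ‖X₃ u - X₂ u‖ ≤ 0 * |u - 0| + θ * |t| := fun u => by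
    rw [hX₃₂ u, zero_mul, zero_add]; exact hdn
  have hℓX₃ : ∀ u, P + t • e - X₃ u = z t - X₂ u := fun u => by rw [hX₃def, hX₂def, hd]; dsimp only; abel
  have hc2 : 0 < 1 - θ := by linarith only [hθ1]
  have hD2 : 0 < (1 - θ) * ‖P + t • e - Q‖ := mul_pos hc2 hN1pos
  have hfar2 : ∀ u, (1 - θ) * ‖P + t • e - Q‖ ≤ ‖P + t • e - X₃ u‖ := fun u => by
    rw [hℓX₃ u]; exact (mul_le_mul_of_nonneg_left (hsq u) hc2.le).trans (hzX₂ u)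
  have hfar2' : ∀ u, (1 - θ) * ‖P + t • e - Q‖ ≤ ‖P + t • e - X₂ u‖ := fun u => by
    rw [hℓX₂ u]
    exact (mul_le_of_le_one_left hN1 (by linarith only [hθ0])).trans (hsq u)
  have hesc2 : ∀ u, (1 - θ) * |u - 0| - 0 ≤ ‖P + t • e - X₃ u‖ := fun u => by
    rw [sub_zero, sub_zero, hℓX₃ u]; exact (mul_le_mul_of_nonneg_left (hsqu u) hc2.le).trans (hzX₂ u)
  have hesc2' : ∀ u, (1 - θ) * |u - 0| - 0 ≤ ‖P + t • e - X₂ u‖ := fun u => by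
    rw [sub_zero, sub_zero, hℓX₂ u]
    exact (mul_le_of_le_one_left (abs_nonneg u) (by linarith only [hθ0])).trans (hsqu u)
  /- the three analytic estimates (large terms: created last) -/
  have hT1 := biotSavart_grad_curveLipschitz (e := 1) (u₀ := 0) (y := z t) one_ne_zero hc2
    hXc hdX hgrowX hX₂c hdX₂ hgrowX₂ hθ0 le_rfl htan hpos hc hD le_rfl hfar hfar' hesc hesc'
  have hT1n := termD1_bound hΓ hθ0 hθ1
  have hT3 := biotSavart_fderiv_norm_le (e := 1) (u₀ := 0) (A := 0) one_ne_zero hc2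
    hX₂c hdX₂ hgrowX₂ one_pos hN1pos le_rfl hfar3 hesc3
  have hT3n := termD3_bound hΓ hθ0 hN1sq hN1
  have hT2 := biotSavart_grad_curveLipschitz (e := 1) (u₀ := 0) (y := P + t • e) one_ne_zero hc2
    hX₃c hdX₃ hgrowX₃ hX₂c hdX₂ hgrowX₂ le_rfl (by positivity : 0 ≤ θ * |t|) htan2 hpos2 hc2 hD2 le_rfl
    hfar2 hfar2' hesc2 hesc2'
  have hT2n := termD2_bound hΓ hθ0 hθ1 hN1sq hN1
  -- the translated line's gradient at `ℓ₁ t` is the line's gradient at `z t`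
  have htrans : fderiv ℝ (fun y : EuclideanSpace ℝ (Fin 3) => ∫ u : ℝ,
      ((‖y - X₃ u‖ ^ 2 + 1 ^ 2) ^ (3 / 2 : ℝ))⁻¹ • cross (deriv X₃ u) (y - X₃ u)) (P + t • e) = fderiv ℝ F₂ (z t) := by
    have h := lineField_translate_fderiv Γ hΓ.le d (P + t • e)
    rw [← hQ, ← he₂] at h
    rw [hF₂def, show z t = P + t • e - d by rw [hd]; abel]
    simp only [hX₃def, hX₂def, one_pow]
    exact h
  rw [htrans, ← hF₂def] at hT2
  rw [← hFdef, ← hF₂def] at hT1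
  rw [← hF₂def] at hT3
  /- assemble -/
  have hsplit : (fderiv ℝ F (z t)) (deriv z t) - (fderiv ℝ F₂ (P + t • e)) e =
      (fderiv ℝ F (z t) - fderiv ℝ F₂ (z t)) (deriv z t) + (fderiv ℝ F₂ (z t) - fderiv ℝ F₂ (P + t • e)) (deriv z t)
        + (fderiv ℝ F₂ (P + t • e)) (deriv z t - e) := by
    have e1 : (fderiv ℝ F (z t) - fderiv ℝ F₂ (z t)) (deriv z t) =
        fderiv ℝ F (z t) (deriv z t) - fderiv ℝ F₂ (z t) (deriv z t) := rfl
    have e2 : (fderiv ℝ F₂ (z t) - fderiv ℝ F₂ (P + t • e)) (deriv z t) =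
        fderiv ℝ F₂ (z t) (deriv z t) - fderiv ℝ F₂ (P + t • e) (deriv z t) := rfl
    rw [e1, e2, map_sub]; abel
  have hzt1 : ‖deriv z t‖ = 1 := hunit t
  have hθt : ‖deriv z t - e‖ ≤ θ := by rw [he]; exact hθ t
  have h1 : ‖(fderiv ℝ F (z t) - fderiv ℝ F₂ (z t)) (deriv z t)‖ ≤
      2 * Real.pi * ((1 - 2 * θ) * (2 * Real.sqrt Γ / 5) + 0) *
        (4 * θ + 24 * θ * ((1 - 2 * θ) * (2 * Real.sqrt Γ / 5) + 0) / ((1 - 2 * θ) * ((1 - 2 * θ) * (2 * Real.sqrt Γ / 5)))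
          + 24 * 0 / ((1 - 2 * θ) * (2 * Real.sqrt Γ / 5))) /
        ((1 - 2 * θ) * ((1 - 2 * θ) * (2 * Real.sqrt Γ / 5)) ^ 3) := by
    refine (ContinuousLinearMap.le_opNorm _ _).trans ?_
    rw [hzt1, mul_one]; exact hT1
  have h2 : ‖(fderiv ℝ F₂ (z t) - fderiv ℝ F₂ (P + t • e)) (deriv z t)‖ ≤
      2 * Real.pi * ((1 - θ) * ‖P + t • e - Q‖ + 0) *
        (4 * 0 + 24 * 0 * ((1 - θ) * ‖P + t • e - Q‖ + 0) / ((1 - θ) * ((1 - θ) * ‖P + t • e - Q‖))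
          + 24 * (θ * |t|) / ((1 - θ) * ‖P + t • e - Q‖)) / ((1 - θ) * ((1 - θ) * ‖P + t • e - Q‖) ^ 3) := by
    refine (ContinuousLinearMap.le_opNorm _ _).trans ?_
    rw [hzt1, mul_one]; exact hT2
  have h3 : ‖(fderiv ℝ F₂ (P + t • e)) (deriv z t - e)‖ ≤
      8 * Real.pi * (‖P + t • e - Q‖ + 0) / (1 * ‖P + t • e - Q‖ ^ 3) * θ := by
    refine (ContinuousLinearMap.le_opNorm _ _).trans ?_
    exact mul_le_mul hT3 hθt (norm_nonneg _) (by positivity)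
  rw [hsplit]
  have hn := (norm_add₃_le (a := (fderiv ℝ F (z t) - fderiv ℝ F₂ (z t)) (deriv z t))
    (b := (fderiv ℝ F₂ (z t) - fderiv ℝ F₂ (P + t • e)) (deriv z t)) (c := (fderiv ℝ F₂ (P + t • e)) (deriv z t - e)))
  have k1 := (mul_le_mul_of_nonneg_left h1 hcΓ).trans hT1n
  have k2 := (mul_le_mul_of_nonneg_left h2 hcΓ).trans hT2n
  have hT3n' : Γ * 4 / (4 * Real.pi) * (8 * Real.pi * (‖P + t • e - Q‖ + 0) / (1 * ‖P + t • e - Q‖ ^ 3) * θ) ≤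
      50 * θ := by rw [← mul_assoc]; exact hT3n
  have k3 := (mul_le_mul_of_nonneg_left h3 hcΓ).trans hT3n'
  have hm := mul_le_mul_of_nonneg_left hn hcΓ
  rw [mul_add, mul_add] at hm
  linarith only [hm, k1, k2, k3, hθ0]

end SelectionBoxRJRung

end Summit.NavierStokesRegularity.NavierStokesRegularity.Theorems
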